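import Literature.Barriers.FinalStateConjecture.ExtremalHorizonBlowupProofs
import Literature.Geometry.Lorentzian.KerrStarCoord
import Literature.NumberTheory.LFunctions.ZetaUniversalityDiscTools
import HarnessLib

/-!
# Barrier catalogue `FinalStateConjecture`: decay of axisymmetric waves on the extremal horizon
# spheres in the square-integrated sense, from the energy estimates of Aretakis 2012
# (`Literature/Barriers/FinalStateConjecture/`, D-0021, D-0014; family `gr`)

Aretakis's Theorem 3 (ATMP 19 (2015)) on extremal Kerr rests, in this library, on one analytic
named fact: the decay of axisymmetric solutions along the horizon spheres `S_τ`
(`Aretakis2012_pointwiseDecay`, Aretakis, JFA 263 (2012), Thm. 5), cf.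
`ExtremalHorizonBlowupProofs.lean`. The printed proof of that theorem (loc. cit. §15) has two
layers: (i) an **`L²(S²)` estimate on the spheres `{r = r₀} ∩ Σ_τ` up to and including the horizon
sphere `r₀ = M`** from the energy estimates of the paper (§15.1, display (15.2) = "(1pointwise)";
Lemma 15.2.1; §15.2.2), and (ii) a spherical Sobolev inequality after commutation with the
second-order Carter operator `Q` (Lemma 15.0.1), which turns (i) into a pointwise bound. The blow-up
mechanism of the 2015 paper, as proved in `ExtremalHorizonBlowupProofs.lean`, consumes the decay of
`ψ, Tψ, TTψ` on `S_τ` only through sphere integrals `∫∫ sin θ · (…)`, i.e. only layer (i) is needed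
(`ExtremalHorizonBlowupFromSphereDecay.lean`). **This file proves layer (i)** in the form in which it
enters there: for a `C¹` function `Φ` on the chart `E4` and the points
`p(τ, r, θ, φ) = (τ, Y_M(r, θ, φ))` of the Kerr–Schild leaves `{t* = τ}` in Kerr's ingoing spheroidal
coordinates (`Kerr.kerrStar`, `KerrStarCoord.lean`; `p(τ, M, θ, φ)` is the point
`Kerr.horizonPoint M τ θ φ` of the horizon sphere `S_τ`, `shellPoint_self`), writing
`∂_ρΦ = dΦ(p)(0, n̂(θ, φ))` for the derivative along the `r`-coordinate lines of the leaf
(`hasDerivAt_comp_shellPoint`):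

* `Kerr.horizonSphereSq_decay_of_shellEnergy` (**proved**): if, for some `R₁ > M`,
  (B) `∫₀^{2π}∫₀^π∫_M^{R₁} sin θ (∂_ρΦ)² dr dθ dφ` is bounded for `τ ≥ τ₀`,
  (A) `∫₀^{2π}∫₀^π∫_M^{R₁} sin θ (r − M)² (∂_ρΦ)² dr dθ dφ → 0` and
  (F) `∫₀^{2π}∫₀^π sin θ Φ(p(τ, R₁, θ, φ))² dθ dφ → 0` as `τ → ∞`,
  then `∫₀^{2π}∫₀^π sin θ Φ(p(τ, M, θ, φ))² dθ dφ → 0`;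
* `Kerr.horizonSphereAbs_decay_of_sq_decay` (**proved**): the `L¹` form
  `∫₀^{2π}∫₀^π sin θ |Φ(p(τ, M, θ, φ))| dθ dφ → 0` follows.

**The argument** is that of Aretakis 2012, §15.2.2 (p. 2828 of the journal version), with a layer
of *fixed* width `h` in place of the `τ`-dependent layer `{M ≤ r ≤ M + τ^{-1/2}}` (which is only
needed for the printed *rate* `τ^{-1}`): along each `r`-line, by the fundamental theorem of calculus
and the Cauchy–Schwarz inequality (`sq_le_of_hasDerivAt`),
`Φ(M)² ≤ 2Φ(M+h)² + 2h ∫_M^{M+h} (∂_ρΦ)²` and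
`Φ(M+h)² ≤ 2Φ(R₁)² + 2(R₁−M) ∫_{M+h}^{R₁} (∂_ρΦ)² ≤ 2Φ(R₁)² + 2(R₁−M)h⁻² ∫_M^{R₁} (r−M)²(∂_ρΦ)²`
(`sq_profile_le`), whence, integrating against `sin θ dθ dφ`,
`m(τ) ≤ 4F(τ) + 4(R₁−M)h⁻² A(τ) + 2h B(τ)`; given `ε`, choose `h` with `2hB ≤ ε/3` and then `τ`
large. In the paper (B) is the uniform boundedness of the non-degenerate energy
`∫_{Σ_τ} J^N_μ[ψ] n^μ` (Thm. 1 of §3, used in §15.2.2: "Using the uniform boundedness of the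
`N`-flux"), (A) is the decay of the degenerate energy `∫_{Σ_τ} J^T_μ[ψ] n^μ ≤ C E₁[ψ] τ^{-2}`
(Thm. 3 of §3) through the comparison `J^N ∼ J^T / D(ρ)` with the degenerate weight `D` vanishing to
second order at `r = M` (proof of Lemma 15.2.1), and (F) is the first display of §15.2.1
(`∫_{S²} ψ²(r, ω) dω ≤ C E₁[ψ] r⁻¹ τ^{-2}` for `r ≥ R₁ > M`); the measure `sin θ dr dθ dφ` is
comparable on `{M ≤ r ≤ R₁}` to the volume form of `Σ_τ` (`ρ² sin θ dr dθ dφ`, `ρ² = r² + M² cos² θ ∈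
[M², 2R₁²]`, SR CMP 329 (2014) §1.2.1). None of (A), (B), (F) is proved here: they are explicit
hypotheses of the theorem (D-0026: no new named facts), to be supplied by the vector-field estimates
of the 2012 paper.

Supporting lemmas (all proved): the FTC estimate `g(a)² ≤ 2g(b)² + 2(b − a)∫_a^b g'²`
(`sq_le_of_hasDerivAt`, with the tree's Cauchy–Schwarz inequality
`VoroninTools.sq_integral_le_mul_integral_sq`), monotonicity of the iterated sphere integral
(`sphereIntegral_mono_on`), and the calculus of the shell points (`shellPoint`,
`hasDerivAt_shellPoint`, `radius_shellPoint`).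

## References

* S. Aretakis, *Decay of axisymmetric solutions of the wave equation on extreme Kerr backgrounds*,
  J. Funct. Anal. 263 (2012) 2770–2831 (arXiv:1110.2006): §3 Thms. 1, 3, 5; §15 (Pointwise
  estimates): (15.2) "(1pointwise)", Lemma 15.2.1, §15.2.1 (decay away from `𝓗⁺`), §15.2.2 (decay
  near `𝓗⁺`: the layer `γ = {r = r₀ + τ^{-1/2}}` and "applying Stokes' theorem") (key `Aretakis2012`).
* S. Aretakis, *Horizon instability of extremal black holes*, Adv. Theor. Math. Phys. 19 (2015)
  507–530 (arXiv:1206.6598), §5.2 and Thm. 3 (key `Aretakis2015`).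
* Y. Shlapentokh-Rothman, Comm. Math. Phys. 329 (2014) 859–891, §1.2.1 (Kerr-star coordinates,
  `√|g| = ρ² sin θ`) (key `ShlapentokhRothman2014KleinGordon`).
-/

noncomputable section

open Set Filter MeasureTheory intervalIntegral
open scoped Topology ContDiff

namespace Literature.Barriers.FinalStateConjecture.Kerr

open Literature.Geometry.Lorentzian

/-! ### One-variable inequalities: the FTC estimate and the layer estimate

The Cauchy–Schwarz inequality `(∫_a^b f)² ≤ (b − a) ∫_a^b f²` is the tree's
`Literature.NumberTheory.LFunctions.VoroninTools.sq_integral_le_mul_integral_sq`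
(`ZetaUniversalityDiscTools.lean`, a Mathlib-only tools file), reused rather than restated. -/

/-- **The FTC estimate**: if `g` has the continuous derivative `g'` on `[a, b]` then
`g(a)² ≤ 2 g(b)² + 2 (b − a) ∫_a^b g'²` (`g(a) = g(b) − ∫_a^b g'`, `(x − y)² ≤ 2x² + 2y²`,
Cauchy–Schwarz). Aretakis 2012, §15.1, the display before (15.2). [cite: Aretakis2012, §15.1] -/
theorem sq_le_of_hasDerivAt {g g' : ℝ → ℝ} {a b : ℝ} (hab : a ≤ b)
    (hg : ∀ x ∈ Icc a b, HasDerivAt g (g' x) x) (hg' : ContinuousOn g' (Icc a b)) :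
    g a ^ 2 ≤ 2 * g b ^ 2 + 2 * (b - a) * ∫ x in a..b, g' x ^ 2 := by
  have hftc : ∫ x in a..b, g' x = g b - g a :=
    intervalIntegral.integral_eq_sub_of_hasDerivAt (by rwa [uIcc_of_le hab])
      (hg'.intervalIntegrable_of_Icc hab)
  have hcs := Literature.NumberTheory.LFunctions.VoroninTools.sq_integral_le_mul_integral_sq hab
    (hg'.intervalIntegrable_of_Icc hab) ((hg'.pow 2).intervalIntegrable_of_Icc hab)
  rw [hftc] at hcs
  have h1 : g a ^ 2 ≤ 2 * g b ^ 2 + 2 * (g b - g a) ^ 2 := by nlinarith [sq_nonneg (g b + (g b - g a))]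
  nlinarith [hcs, h1]

/-- **The layer estimate along one `r`-line** (Aretakis 2012, §15.2.2, with a fixed layer
`[M, M + h]`): for `g` with continuous derivative `g'` on `[M, R₁]` and `0 < h < R₁ − M`,
`g(M)² ≤ 4 g(R₁)² + 4 (R₁ − M) h⁻² ∫_M^{R₁} (r − M)² g'² + 2 h ∫_M^{R₁} g'²`.
[cite: Aretakis2012, §15.2.2] -/
theorem sq_profile_le {g g' : ℝ → ℝ} {M R₁ h : ℝ} (hh : 0 < h) (hhR : M + h < R₁)
    (hg : ∀ x ∈ Icc M R₁, HasDerivAt g (g' x) x) (hg' : ContinuousOn g' (Icc M R₁)) :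
    g M ^ 2 ≤ 4 * g R₁ ^ 2 + 4 * (R₁ - M) / h ^ 2 * (∫ r in M..R₁, (r - M) ^ 2 * g' r ^ 2) +
      2 * h * ∫ r in M..R₁, g' r ^ 2 := by
  have hMh : M ≤ M + h := by linarith
  have hMR : M ≤ R₁ := by linarith
  have hsub1 : Icc M (M + h) ⊆ Icc M R₁ := Icc_subset_Icc le_rfl hhR.le
  have hsub2 : Icc (M + h) R₁ ⊆ Icc M R₁ := Icc_subset_Icc hMh le_rfl
  -- the two FTC estimates
  have e1 := sq_le_of_hasDerivAt hMh (fun x hx ↦ hg x (hsub1 hx)) (hg'.mono hsub1)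
  have e2 := sq_le_of_hasDerivAt hhR.le (fun x hx ↦ hg x (hsub2 hx)) (hg'.mono hsub2)
  -- integrability and signs
  have hg2 : ContinuousOn (fun r ↦ g' r ^ 2) (Icc M R₁) := hg'.pow 2
  have hw : ContinuousOn (fun r ↦ (r - M) ^ 2 * g' r ^ 2) (Icc M R₁) :=
    ((continuousOn_id.sub continuousOn_const).pow 2).mul hg2
  have iw1 : IntervalIntegrable (fun r ↦ (r - M) ^ 2 * g' r ^ 2) volume M (M + h) :=
    (hw.mono hsub1).intervalIntegrable_of_Icc hMh
  have iw2 : IntervalIntegrable (fun r ↦ (r - M) ^ 2 * g' r ^ 2) volume (M + h) R₁ :=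
    (hw.mono hsub2).intervalIntegrable_of_Icc hhR.le
  have ig : IntervalIntegrable (fun r ↦ g' r ^ 2) volume M R₁ := hg2.intervalIntegrable_of_Icc hMR
  have ig2 : IntervalIntegrable (fun r ↦ g' r ^ 2) volume (M + h) R₁ :=
    (hg2.mono hsub2).intervalIntegrable_of_Icc hhR.le
  -- `∫_M^{M+h} g'² ≤ ∫_M^{R₁} g'²`
  have l1 : ∫ r in M..(M + h), g' r ^ 2 ≤ ∫ r in M..R₁, g' r ^ 2 :=
    intervalIntegral.integral_mono_interval le_rfl hMh hhR.le
      (Eventually.of_forall fun r ↦ sq_nonneg _) ig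
  -- `h² ∫_{M+h}^{R₁} g'² ≤ ∫_M^{R₁} (r − M)² g'²`
  have l2 : h ^ 2 * ∫ r in (M + h)..R₁, g' r ^ 2 ≤ ∫ r in M..R₁, (r - M) ^ 2 * g' r ^ 2 := by
    rw [← intervalIntegral.integral_add_adjacent_intervals iw1 iw2]
    have h0 : 0 ≤ ∫ r in M..(M + h), (r - M) ^ 2 * g' r ^ 2 :=
      intervalIntegral.integral_nonneg hMh fun r _ ↦ by positivity
    have hmono : h ^ 2 * ∫ r in (M + h)..R₁, g' r ^ 2 ≤ ∫ r in (M + h)..R₁, (r - M) ^ 2 * g' r ^ 2 := by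
      rw [← intervalIntegral.integral_const_mul]
      refine intervalIntegral.integral_mono_on hhR.le (ig2.const_mul _) iw2 fun r hr ↦ ?_
      have h1 : h ≤ r - M := by linarith [hr.1]
      exact mul_le_mul_of_nonneg_right (pow_le_pow_left₀ hh.le h1 2) (sq_nonneg _)
    linarith
  have hW : 0 ≤ ∫ r in M..R₁, (r - M) ^ 2 * g' r ^ 2 :=
    intervalIntegral.integral_nonneg hMR fun r _ ↦ by positivity
  have hB2 : 0 ≤ ∫ r in (M + h)..R₁, g' r ^ 2 :=
    intervalIntegral.integral_nonneg hhR.le fun r _ ↦ sq_nonneg _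
  -- combine
  have hh2 : 0 < h ^ 2 := by positivity
  have l2' : ∫ r in (M + h)..R₁, g' r ^ 2 ≤ 1 / h ^ 2 * ∫ r in M..R₁, (r - M) ^ 2 * g' r ^ 2 := by
    rw [one_div, ← div_eq_inv_mul, le_div_iff₀ hh2]; linarith
  have hRM : 0 ≤ R₁ - (M + h) := by linarith
  have hRM' : R₁ - (M + h) ≤ R₁ - M := by linarith
  calc g M ^ 2 ≤ 2 * g (M + h) ^ 2 + 2 * ((M + h) - M) * ∫ r in M..(M + h), g' r ^ 2 := e1
    _ ≤ 2 * (2 * g R₁ ^ 2 + 2 * (R₁ - (M + h)) * ∫ r in (M + h)..R₁, g' r ^ 2) +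
        2 * h * ∫ r in M..R₁, g' r ^ 2 := by
        have : (M + h) - M = h := by ring
        rw [this]
        nlinarith [e2, l1, hh.le]
    _ ≤ 2 * (2 * g R₁ ^ 2 + 2 * (R₁ - M) * (1 / h ^ 2 * ∫ r in M..R₁, (r - M) ^ 2 * g' r ^ 2)) +
        2 * h * ∫ r in M..R₁, g' r ^ 2 := by
        have := mul_le_mul hRM' l2' hB2 (by linarith)
        nlinarith [this]
    _ = 4 * g R₁ ^ 2 + 4 * (R₁ - M) / h ^ 2 * (∫ r in M..R₁, (r - M) ^ 2 * g' r ^ 2) +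
        2 * h * ∫ r in M..R₁, g' r ^ 2 := by
        field_simp
        ring

/-! ### Iterated sphere integrals: monotonicity and the integral of `sin θ` -/

/-- **Monotonicity of the iterated sphere integral** for jointly continuous integrands compared on
the rectangle `[0, π] × [0, 2π]`. [folklore] -/
theorem sphereIntegral_mono_on {f g : ℝ → ℝ → ℝ} (hf : Continuous (Function.uncurry f))
    (hg : Continuous (Function.uncurry g))
    (h : ∀ θ ∈ Icc (0 : ℝ) Real.pi, ∀ φ ∈ Icc (0 : ℝ) (2 * Real.pi), f θ φ ≤ g θ φ) :
    (∫ φ in (0 : ℝ)..2 * Real.pi, ∫ θ in (0 : ℝ)..Real.pi, f θ φ) ≤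
      ∫ φ in (0 : ℝ)..2 * Real.pi, ∫ θ in (0 : ℝ)..Real.pi, g θ φ := by
  have hf_θ : ∀ φ, Continuous fun θ ↦ f θ φ := fun φ ↦
    hf.comp (Continuous.prodMk continuous_id continuous_const)
  have hg_θ : ∀ φ, Continuous fun θ ↦ g θ φ := fun φ ↦
    hg.comp (Continuous.prodMk continuous_id continuous_const)
  have hIf : Continuous fun φ ↦ ∫ θ in (0 : ℝ)..Real.pi, f θ φ := by
    have h' : Continuous (Function.uncurry fun φ θ ↦ f θ φ) :=
      hf.comp (Continuous.prodMk continuous_snd continuous_fst)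
    exact intervalIntegral.continuous_parametric_intervalIntegral_of_continuous' h' 0 Real.pi
  have hIg : Continuous fun φ ↦ ∫ θ in (0 : ℝ)..Real.pi, g θ φ := by
    have h' : Continuous (Function.uncurry fun φ θ ↦ g θ φ) :=
      hg.comp (Continuous.prodMk continuous_snd continuous_fst)
    exact intervalIntegral.continuous_parametric_intervalIntegral_of_continuous' h' 0 Real.pi
  refine intervalIntegral.integral_mono_on (by positivity) (hIf.intervalIntegrable _ _)
    (hIg.intervalIntegrable _ _) fun φ hφ ↦ ?_
  exact intervalIntegral.integral_mono_on Real.pi_pos.le ((hf_θ φ).intervalIntegrable _ _)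
    ((hg_θ φ).intervalIntegrable _ _) fun θ hθ ↦ h θ hθ φ hφ

/-- `∫₀^{2π} ∫₀^π c sin θ dθ dφ = 4πc`. [folklore] -/
theorem sphereIntegral_const_mul_sin (c : ℝ) :
    (∫ _φ in (0 : ℝ)..2 * Real.pi, ∫ θ in (0 : ℝ)..Real.pi, c * Real.sin θ) = 4 * Real.pi * c := by
  rw [intervalIntegral.integral_const_mul, integral_sin, Real.cos_zero, Real.cos_pi,
    intervalIntegral.integral_const, smul_eq_mul]
  ring

/-! ### The shell points `p(τ, r, θ, φ) = (τ, Y_M(r, θ, φ))` of the Kerr–Schild leaves -/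

/-- **The shell point** `p(τ, r, θ, φ) = (τ, Y_M(r, θ, φ))`: the point of the Kerr–Schild leaf
`{t* = τ}` with Kerr ingoing spheroidal coordinates `(r, θ, φ)` (`Kerr.kerrStar`, spin `a = M`);
for `r = M` it is the point `horizonPoint M τ θ φ` of the horizon sphere `S_τ` (`shellPoint_self`).
Aretakis, JFA 263 (2012), §2.4–2.5 (the coordinates `(ρ, ω)` on `Σ_τ`). [cite: Aretakis2012, §2.5] -/
def shellPoint (M τ r θ φ : ℝ) : E4 := E4.ofTimeSpace τ (Kerr.kerrStar M r θ φ)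

/-- Components of the shell point. [cite: Aretakis2012, §2.5] -/
theorem shellPoint_eq_toLp (M τ r θ φ : ℝ) :
    shellPoint M τ r θ φ = WithLp.toLp 2 ![τ, (r * Real.cos φ - M * Real.sin φ) * Real.sin θ,
      (r * Real.sin φ + M * Real.cos φ) * Real.sin θ, r * Real.cos θ] := by
  ext i
  fin_cases i
  · rfl
  · show shellPoint M τ r θ φ (Fin.succ 0) = _
    rw [shellPoint, E4.ofTimeSpace_apply_succ, Kerr.kerrStar_apply_zero]
    rfl
  · show shellPoint M τ r θ φ (Fin.succ 1) = _
    rw [shellPoint, E4.ofTimeSpace_apply_succ, Kerr.kerrStar_apply_one]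
    rfl
  · show shellPoint M τ r θ φ (Fin.succ 2) = _
    rw [shellPoint, E4.ofTimeSpace_apply_succ, Kerr.kerrStar_apply_two]
    rfl

/-- `t*` of the shell point. [cite: Aretakis2012, §2.5] -/
@[simp] theorem shellPoint_apply_zero (M τ r θ φ : ℝ) : shellPoint M τ r θ φ 0 = τ := rfl

/-- **At `r = M` the shell point is the horizon point** `p_τ(θ, φ)` of
`ExtremalHorizonChargeConservationProofs.lean`. [cite: Aretakis2015, §5.2] -/
theorem shellPoint_self (M τ θ φ : ℝ) : shellPoint M τ M θ φ = horizonPoint M τ θ φ := by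
  rw [shellPoint_eq_toLp, horizonPoint_eq_toLp]
  congr 1
  funext i
  fin_cases i <;> simp <;> ring

/-- The Kerr–Schild radius of the shell point is the coordinate `r` (`r > 0`). [cite: Aretakis2012, §2.5] -/
theorem radius_shellPoint (M τ : ℝ) {r : ℝ} (hr : 0 < r) (θ φ : ℝ) :
    Kerr.radius M (shellPoint M τ r θ φ) = r := by
  rw [shellPoint, Kerr.radius_ofTimeSpace, Kerr.radius_kerrStar M hr]

/-- **The `r`-lines of the leaf**: `∂_r p(τ, r, θ, φ) = (0, n̂(θ, φ))` (`Kerr.hasDerivAt_kerrStar_r`).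
[cite: Aretakis2012, §2.5] -/
theorem hasDerivAt_shellPoint (M τ r θ φ : ℝ) :
    HasDerivAt (fun s ↦ shellPoint M τ s θ φ) (E4.spaceEmbed (sphRadial θ φ)) r := by
  have h := (E4.spaceEmbed.hasFDerivAt).comp_hasDerivAt r (Kerr.hasDerivAt_kerrStar_r M r θ φ)
  have h2 := h.const_add (τ • E4.basisVector 0)
  have hfun : (fun s ↦ shellPoint M τ s θ φ) =
      fun s ↦ τ • E4.basisVector 0 + (E4.spaceEmbed ∘ fun s ↦ Kerr.kerrStar M s θ φ) s :=
    funext fun s ↦ E4.ofTimeSpace_eq_smul_add' τ _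
  rw [hfun]
  exact h2

/-- **The radial derivative along the leaf**: for `Φ` differentiable at the shell point,
`∂_ρ (Φ ∘ p) = dΦ(p)(0, n̂)`. [cite: Aretakis2012, §15.1] -/
theorem hasDerivAt_comp_shellPoint {Φ : E4 → ℝ} {M τ r θ φ : ℝ}
    (hΦ : DifferentiableAt ℝ Φ (shellPoint M τ r θ φ)) :
    HasDerivAt (fun s ↦ Φ (shellPoint M τ s θ φ))
      (fderiv ℝ Φ (shellPoint M τ r θ φ) (E4.spaceEmbed (sphRadial θ φ))) r :=
  hΦ.hasFDerivAt.comp_hasDerivAt r (hasDerivAt_shellPoint M τ r θ φ)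

/-- Joint continuity of `(r, θ, φ) ↦ p(τ, r, θ, φ)`. [folklore] -/
theorem continuous_shellPoint (M τ : ℝ) :
    Continuous fun q : ℝ × ℝ × ℝ ↦ shellPoint M τ q.1 q.2.1 q.2.2 := by
  simp only [shellPoint_eq_toLp]
  refine continuous_toLp_four ?_ ?_ ?_ ?_ <;> fun_prop

/-- Joint continuity of the radial direction `(θ, φ) ↦ (0, n̂(θ, φ))`. [folklore] -/
theorem continuous_spaceEmbed_sphRadial :
    Continuous fun q : ℝ × ℝ ↦ E4.spaceEmbed (sphRadial q.1 q.2) := by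
  refine E4.spaceEmbed.continuous.comp ?_
  simp only [sphRadial_eq]
  fun_prop

/-! ### Decay on the horizon spheres in `L²` from the three energy statements -/

/-- **`L²` decay on the horizon spheres from the energy estimates (Aretakis 2012, §15.2.2, layer
of fixed width).** Let `Φ` be `C¹` on `E4`, `R₁ > M`, and write `p = shellPoint M τ r θ φ`,
`∂_ρΦ = dΦ(p)(0, n̂(θ, φ))`. Assume
(B) `∫₀^{2π}∫₀^π∫_M^{R₁} sin θ (∂_ρΦ)² ≤ C` for `τ ≥ τ₀` [in the source: uniform boundedness of
the non-degenerate energy `∫_{Σ_τ} J^N_μ[ψ]n^μ`, Thm. 1, "using the uniform boundedness of the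
`N`-flux" in §15.2.2],
(A) `∫₀^{2π}∫₀^π∫_M^{R₁} sin θ (r − M)²(∂_ρΦ)² → 0` [decay of the degenerate energy
`∫_{Σ_τ} J^T_μ[ψ]n^μ ≤ C E₁ τ^{-2}`, Thm. 3, with `J^N ∼ J^T/D(ρ)`, proof of Lemma 15.2.1], and
(F) `∫₀^{2π}∫₀^π sin θ Φ(p(τ, R₁, θ, φ))² → 0` [§15.2.1, first display:
`∫_{S²} ψ² (r, ω) dω ≤ C E₁ r⁻¹ τ^{-2}`, `r ≥ R₁`].
Then `∫₀^{2π}∫₀^π sin θ Φ(p_τ(θ, φ))² dθ dφ → 0` on the horizon spheres `S_τ`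
(`p_τ = horizonPoint M τ`). Proof: `sq_profile_le` along each `r`-line, integrated against
`sin θ dθ dφ`: `m(τ) ≤ 4F(τ) + 4(R₁ − M)h⁻²A(τ) + 2hB(τ)`, with `h` chosen from `ε` first.
[cite: Aretakis2012, §15.2.2 and Thm. 5] -/
theorem horizonSphereSq_decay_of_shellEnergy {M R₁ τ₀ C : ℝ} (hR₁ : M < R₁) {Φ : E4 → ℝ}
    (hΦ : ContDiff ℝ 1 Φ)
    (hB : ∀ τ : ℝ, τ₀ ≤ τ → (∫ φ in (0 : ℝ)..2 * Real.pi, ∫ θ in (0 : ℝ)..Real.pi, ∫ r in M..R₁,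
        Real.sin θ * (fderiv ℝ Φ (shellPoint M τ r θ φ) (E4.spaceEmbed (sphRadial θ φ))) ^ 2) ≤ C)
    (hA : ∀ ε : ℝ, 0 < ε → ∃ τ₁ : ℝ, ∀ τ : ℝ, τ₁ ≤ τ →
        (∫ φ in (0 : ℝ)..2 * Real.pi, ∫ θ in (0 : ℝ)..Real.pi, ∫ r in M..R₁,
          Real.sin θ * ((r - M) ^ 2 *
            (fderiv ℝ Φ (shellPoint M τ r θ φ) (E4.spaceEmbed (sphRadial θ φ))) ^ 2)) ≤ ε)
    (hF : ∀ ε : ℝ, 0 < ε → ∃ τ₁ : ℝ, ∀ τ : ℝ, τ₁ ≤ τ →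
        (∫ φ in (0 : ℝ)..2 * Real.pi, ∫ θ in (0 : ℝ)..Real.pi,
          Real.sin θ * Φ (shellPoint M τ R₁ θ φ) ^ 2) ≤ ε) :
    ∀ ε : ℝ, 0 < ε → ∃ τ₁ : ℝ, ∀ τ : ℝ, τ₁ ≤ τ →
      (∫ φ in (0 : ℝ)..2 * Real.pi, ∫ θ in (0 : ℝ)..Real.pi,
        Real.sin θ * Φ (horizonPoint M τ θ φ) ^ 2) ≤ ε := by
  intro ε hε
  have hRM : 0 < R₁ - M := sub_pos.mpr hR₁
  -- the width `h` of the layer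
  obtain ⟨C', hC'def⟩ : ∃ C' : ℝ, max C 1 = C' := ⟨_, rfl⟩
  have hC'1 : 1 ≤ C' := by rw [← hC'def]; exact le_max_right _ _
  have hC'pos : 0 < C' := lt_of_lt_of_le one_pos hC'1
  have hCC' : C ≤ C' := by rw [← hC'def]; exact le_max_left _ _
  obtain ⟨h, hhdef⟩ : ∃ h : ℝ, min ((R₁ - M) / 2) (ε / (6 * C')) = h := ⟨_, rfl⟩
  have hh : 0 < h := by rw [← hhdef]; exact lt_min (by linarith) (by positivity)
  have hh1 : h ≤ (R₁ - M) / 2 := by rw [← hhdef]; exact min_le_left _ _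
  have hh2 : h ≤ ε / (6 * C') := by rw [← hhdef]; exact min_le_right _ _
  have hhR : M + h < R₁ := by linarith
  have hhε : 2 * h * C' ≤ ε / 3 := by
    calc 2 * h * C' ≤ 2 * (ε / (6 * C')) * C' := by gcongr
      _ = ε / 3 := by field_simp; ring
  -- the times
  obtain ⟨τA, hτA⟩ := hA (ε * h ^ 2 / (12 * (R₁ - M))) (by positivity)
  obtain ⟨τF, hτF⟩ := hF (ε / 12) (by positivity)
  refine ⟨max τ₀ (max τA τF), fun τ hτ ↦ ?_⟩
  have hτ₀ : τ₀ ≤ τ := le_trans (le_max_left _ _) hτ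
  have hτA' : τA ≤ τ := le_trans (le_trans (le_max_left _ _) (le_max_right _ _)) hτ
  have hτF' : τF ≤ τ := le_trans (le_trans (le_max_right _ _) (le_max_right _ _)) hτ
  have hBτ := hB τ hτ₀
  have hAτ := hτA τ hτA'
  have hFτ := hτF τ hτF'
  -- the radial derivative as a jointly continuous function of `(r, θ, φ)`
  set D : ℝ → ℝ → ℝ → ℝ := fun r θ φ ↦
    fderiv ℝ Φ (shellPoint M τ r θ φ) (E4.spaceEmbed (sphRadial θ φ)) with hDdef
  have hdiff : Differentiable ℝ Φ := hΦ.differentiable one_ne_zero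
  have hDc : Continuous fun q : ℝ × ℝ × ℝ ↦ D q.1 q.2.1 q.2.2 :=
    ((hΦ.continuous_fderiv one_ne_zero).comp (continuous_shellPoint M τ)).clm_apply
      (continuous_spaceEmbed_sphRadial.comp continuous_snd)
  have hΦc : Continuous Φ := hΦ.continuous
  -- the pointwise estimate along each `r`-line
  have hpt : ∀ θ φ, Φ (shellPoint M τ M θ φ) ^ 2 ≤ 4 * Φ (shellPoint M τ R₁ θ φ) ^ 2 +
      4 * (R₁ - M) / h ^ 2 * (∫ r in M..R₁, (r - M) ^ 2 * D r θ φ ^ 2) +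
        2 * h * ∫ r in M..R₁, D r θ φ ^ 2 := by
    intro θ φ
    refine sq_profile_le (g := fun r ↦ Φ (shellPoint M τ r θ φ)) (g' := fun r ↦ D r θ φ) hh hhR
      (fun r _ ↦ hasDerivAt_comp_shellPoint (hdiff _)) ?_
    exact (hDc.comp (Continuous.prodMk continuous_id continuous_const :
      Continuous fun r : ℝ ↦ ((r, θ, φ) : ℝ × ℝ × ℝ))).continuousOn
  -- the three integrands on the sphere, and their continuity
  set fF : ℝ → ℝ → ℝ := fun θ φ ↦ Real.sin θ * Φ (shellPoint M τ R₁ θ φ) ^ 2 with hfFdef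
  set fA : ℝ → ℝ → ℝ := fun θ φ ↦ ∫ r in M..R₁, Real.sin θ * ((r - M) ^ 2 * D r θ φ ^ 2) with hfAdef
  set fB : ℝ → ℝ → ℝ := fun θ φ ↦ ∫ r in M..R₁, Real.sin θ * D r θ φ ^ 2 with hfBdef
  have hsinc : Continuous fun q : ℝ × ℝ ↦ Real.sin q.1 := Real.continuous_sin.comp continuous_fst
  have hfFc : Continuous (Function.uncurry fF) :=
    hsinc.mul ((hΦc.comp ((continuous_shellPoint M τ).comp
      (Continuous.prodMk continuous_const continuous_id :
        Continuous fun q : ℝ × ℝ ↦ ((R₁, q) : ℝ × ℝ × ℝ)))).pow 2)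
  have hDc' : Continuous fun p : (ℝ × ℝ) × ℝ ↦ D p.2 p.1.1 p.1.2 :=
    hDc.comp (Continuous.prodMk continuous_snd continuous_fst :
      Continuous fun p : (ℝ × ℝ) × ℝ ↦ ((p.2, p.1) : ℝ × ℝ × ℝ))
  have hfAc : Continuous (Function.uncurry fA) := by
    have hi : Continuous (Function.uncurry fun (q : ℝ × ℝ) (r : ℝ) ↦
        Real.sin q.1 * ((r - M) ^ 2 * D r q.1 q.2 ^ 2)) :=
      (Real.continuous_sin.comp (continuous_fst.comp continuous_fst)).mul
        (((continuous_snd.sub continuous_const).pow 2).mul (hDc'.pow 2))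
    exact intervalIntegral.continuous_parametric_intervalIntegral_of_continuous' hi M R₁
  have hfBc : Continuous (Function.uncurry fB) := by
    have hi : Continuous (Function.uncurry fun (q : ℝ × ℝ) (r : ℝ) ↦ Real.sin q.1 * D r q.1 q.2 ^ 2) :=
      (Real.continuous_sin.comp (continuous_fst.comp continuous_fst)).mul (hDc'.pow 2)
    exact intervalIntegral.continuous_parametric_intervalIntegral_of_continuous' hi M R₁
  have hlhs : Continuous (Function.uncurry fun θ φ ↦ Real.sin θ * Φ (horizonPoint M τ θ φ) ^ 2) :=
    hsinc.mul ((hΦc.comp (continuous_horizonPoint_angles M τ)).pow 2)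
  -- integrate the pointwise estimate against `sin θ dθ dφ`
  have hgF : Continuous (Function.uncurry fun θ φ ↦ 4 * fF θ φ) := continuous_const.mul hfFc
  have hgA : Continuous (Function.uncurry fun θ φ ↦ 4 * (R₁ - M) / h ^ 2 * fA θ φ) :=
    continuous_const.mul hfAc
  have hgB : Continuous (Function.uncurry fun θ φ ↦ 2 * h * fB θ φ) := continuous_const.mul hfBc
  have hgAB : Continuous (Function.uncurry fun θ φ ↦ 4 * (R₁ - M) / h ^ 2 * fA θ φ + 2 * h * fB θ φ) :=
    hgA.add hgB
  have hg : Continuous (Function.uncurry fun θ φ ↦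
      4 * fF θ φ + (4 * (R₁ - M) / h ^ 2 * fA θ φ + 2 * h * fB θ φ)) := hgF.add hgAB
  have hmono := sphereIntegral_mono_on (f := fun θ φ ↦ Real.sin θ * Φ (horizonPoint M τ θ φ) ^ 2)
    (g := fun θ φ ↦ 4 * fF θ φ + (4 * (R₁ - M) / h ^ 2 * fA θ φ + 2 * h * fB θ φ)) hlhs hg
    (fun θ hθ φ _ ↦ by
      have hs : 0 ≤ Real.sin θ := Real.sin_nonneg_of_nonneg_of_le_pi hθ.1 hθ.2
      have h1 := mul_le_mul_of_nonneg_left (hpt θ φ) hs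
      rw [shellPoint_self] at h1
      have eA : fA θ φ = Real.sin θ * ∫ r in M..R₁, (r - M) ^ 2 * D r θ φ ^ 2 := by
        show (∫ r in M..R₁, Real.sin θ * ((r - M) ^ 2 * D r θ φ ^ 2)) = _
        exact intervalIntegral.integral_const_mul _ _
      have eB : fB θ φ = Real.sin θ * ∫ r in M..R₁, D r θ φ ^ 2 := by
        show (∫ r in M..R₁, Real.sin θ * D r θ φ ^ 2) = _
        exact intervalIntegral.integral_const_mul _ _
      have eF : fF θ φ = Real.sin θ * Φ (shellPoint M τ R₁ θ φ) ^ 2 := rfl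
      rw [eA, eB, eF]
      nlinarith [h1])
  -- evaluate the right-hand side
  have hsum : (∫ φ in (0 : ℝ)..2 * Real.pi, ∫ θ in (0 : ℝ)..Real.pi,
      (4 * fF θ φ + (4 * (R₁ - M) / h ^ 2 * fA θ φ + 2 * h * fB θ φ))) =
      4 * (∫ φ in (0 : ℝ)..2 * Real.pi, ∫ θ in (0 : ℝ)..Real.pi, fF θ φ) +
        (4 * (R₁ - M) / h ^ 2 * (∫ φ in (0 : ℝ)..2 * Real.pi, ∫ θ in (0 : ℝ)..Real.pi, fA θ φ) +
          2 * h * ∫ φ in (0 : ℝ)..2 * Real.pi, ∫ θ in (0 : ℝ)..Real.pi, fB θ φ) := by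
    rw [sphereIntegral_add hgF hgAB, sphereIntegral_add hgA hgB,
      sphereIntegral_const_mul, sphereIntegral_const_mul, sphereIntegral_const_mul]
  rw [hsum] at hmono
  -- the three bounds
  have hFτ' : (∫ φ in (0 : ℝ)..2 * Real.pi, ∫ θ in (0 : ℝ)..Real.pi, fF θ φ) ≤ ε / 12 := hFτ
  have hAτ' : (∫ φ in (0 : ℝ)..2 * Real.pi, ∫ θ in (0 : ℝ)..Real.pi, fA θ φ) ≤
      ε * h ^ 2 / (12 * (R₁ - M)) := hAτ
  have hBτ' : (∫ φ in (0 : ℝ)..2 * Real.pi, ∫ θ in (0 : ℝ)..Real.pi, fB θ φ) ≤ C' := hBτ.trans hCC'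
  have hcoef : 0 ≤ 4 * (R₁ - M) / h ^ 2 := by positivity
  have hA'' : 4 * (R₁ - M) / h ^ 2 * (∫ φ in (0 : ℝ)..2 * Real.pi, ∫ θ in (0 : ℝ)..Real.pi, fA θ φ) ≤
      ε / 3 := by
    calc 4 * (R₁ - M) / h ^ 2 * (∫ φ in (0 : ℝ)..2 * Real.pi, ∫ θ in (0 : ℝ)..Real.pi, fA θ φ)
        ≤ 4 * (R₁ - M) / h ^ 2 * (ε * h ^ 2 / (12 * (R₁ - M))) :=
          mul_le_mul_of_nonneg_left hAτ' hcoef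
      _ = ε / 3 := by field_simp; ring
  have hB'' : 2 * h * (∫ φ in (0 : ℝ)..2 * Real.pi, ∫ θ in (0 : ℝ)..Real.pi, fB θ φ) ≤ ε / 3 :=
    (mul_le_mul_of_nonneg_left hBτ' (by positivity)).trans hhε
  linarith

/-- **`L¹` decay on the horizon spheres from `L²` decay**: if
`∫₀^{2π}∫₀^π sin θ Φ(p_τ)² dθ dφ → 0` then `∫₀^{2π}∫₀^π sin θ |Φ(p_τ)| dθ dφ → 0` (`Φ` continuous;
`sin θ |Φ| ≤ (δ/2) sin θ + (2δ)⁻¹ sin θ Φ²` on `[0, π]`, `∫∫ sin θ = 4π`). [folklore] -/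
theorem horizonSphereAbs_decay_of_sq_decay {M : ℝ} {Φ : E4 → ℝ} (hΦ : Continuous Φ)
    (h : ∀ ε : ℝ, 0 < ε → ∃ τ₁ : ℝ, ∀ τ : ℝ, τ₁ ≤ τ →
      (∫ φ in (0 : ℝ)..2 * Real.pi, ∫ θ in (0 : ℝ)..Real.pi,
        Real.sin θ * Φ (horizonPoint M τ θ φ) ^ 2) ≤ ε) :
    ∀ ε : ℝ, 0 < ε → ∃ τ₁ : ℝ, ∀ τ : ℝ, τ₁ ≤ τ →
      (∫ φ in (0 : ℝ)..2 * Real.pi, ∫ θ in (0 : ℝ)..Real.pi,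
        Real.sin θ * |Φ (horizonPoint M τ θ φ)|) ≤ ε := by
  intro ε hε
  have hπ := Real.pi_pos
  obtain ⟨δ, hδdef⟩ : ∃ δ : ℝ, ε / (4 * Real.pi) = δ := ⟨_, rfl⟩
  have hδ : 0 < δ := by rw [← hδdef]; positivity
  obtain ⟨τ₁, hτ₁⟩ := h (ε * δ) (by positivity)
  refine ⟨τ₁, fun τ hτ ↦ ?_⟩
  have hm := hτ₁ τ hτ
  have hsinc : Continuous fun q : ℝ × ℝ ↦ Real.sin q.1 := Real.continuous_sin.comp continuous_fst
  have hΦp : Continuous fun q : ℝ × ℝ ↦ Φ (horizonPoint M τ q.1 q.2) :=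
    hΦ.comp (continuous_horizonPoint_angles M τ)
  have hpt : ∀ θ ∈ Icc (0 : ℝ) Real.pi, ∀ φ ∈ Icc (0 : ℝ) (2 * Real.pi),
      Real.sin θ * |Φ (horizonPoint M τ θ φ)| ≤
        δ / 2 * Real.sin θ + 1 / (2 * δ) * (Real.sin θ * Φ (horizonPoint M τ θ φ) ^ 2) := by
    intro θ hθ φ _
    have hs : 0 ≤ Real.sin θ := Real.sin_nonneg_of_nonneg_of_le_pi hθ.1 hθ.2
    have key : |Φ (horizonPoint M τ θ φ)| ≤ δ / 2 + 1 / (2 * δ) * Φ (horizonPoint M τ θ φ) ^ 2 := by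
      have hx : 0 ≤ (|Φ (horizonPoint M τ θ φ)| - δ) ^ 2 := sq_nonneg _
      have habs : |Φ (horizonPoint M τ θ φ)| ^ 2 = Φ (horizonPoint M τ θ φ) ^ 2 := sq_abs _
      rw [show δ / 2 + 1 / (2 * δ) * Φ (horizonPoint M τ θ φ) ^ 2 =
        (δ ^ 2 + Φ (horizonPoint M τ θ φ) ^ 2) / (2 * δ) by field_simp]
      rw [le_div_iff₀ (by positivity)]
      nlinarith [hx, habs]
    calc Real.sin θ * |Φ (horizonPoint M τ θ φ)|
        ≤ Real.sin θ * (δ / 2 + 1 / (2 * δ) * Φ (horizonPoint M τ θ φ) ^ 2) :=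
          mul_le_mul_of_nonneg_left key hs
      _ = δ / 2 * Real.sin θ + 1 / (2 * δ) * (Real.sin θ * Φ (horizonPoint M τ θ φ) ^ 2) := by ring
  have hf : Continuous (Function.uncurry fun θ φ ↦ Real.sin θ * |Φ (horizonPoint M τ θ φ)|) :=
    hsinc.mul hΦp.abs
  have hg1 : Continuous (Function.uncurry fun θ (_ : ℝ) ↦ δ / 2 * Real.sin θ) :=
    continuous_const.mul hsinc
  have hg2 : Continuous (Function.uncurry fun θ φ ↦
      1 / (2 * δ) * (Real.sin θ * Φ (horizonPoint M τ θ φ) ^ 2)) :=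
    continuous_const.mul (hsinc.mul (hΦp.pow 2))
  have hg : Continuous (Function.uncurry fun θ φ ↦
      δ / 2 * Real.sin θ + 1 / (2 * δ) * (Real.sin θ * Φ (horizonPoint M τ θ φ) ^ 2)) := hg1.add hg2
  have hmono := sphereIntegral_mono_on hf hg hpt
  have hsum : (∫ φ in (0 : ℝ)..2 * Real.pi, ∫ θ in (0 : ℝ)..Real.pi,
      (δ / 2 * Real.sin θ + 1 / (2 * δ) * (Real.sin θ * Φ (horizonPoint M τ θ φ) ^ 2))) =
      4 * Real.pi * (δ / 2) + 1 / (2 * δ) * ∫ φ in (0 : ℝ)..2 * Real.pi, ∫ θ in (0 : ℝ)..Real.pi,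
        Real.sin θ * Φ (horizonPoint M τ θ φ) ^ 2 := by
    rw [sphereIntegral_add hg1 hg2, sphereIntegral_const_mul_sin, sphereIntegral_const_mul]
  rw [hsum] at hmono
  have h2 : 1 / (2 * δ) * (∫ φ in (0 : ℝ)..2 * Real.pi, ∫ θ in (0 : ℝ)..Real.pi,
      Real.sin θ * Φ (horizonPoint M τ θ φ) ^ 2) ≤ ε / 2 := by
    calc 1 / (2 * δ) * (∫ φ in (0 : ℝ)..2 * Real.pi, ∫ θ in (0 : ℝ)..Real.pi,
        Real.sin θ * Φ (horizonPoint M τ θ φ) ^ 2) ≤ 1 / (2 * δ) * (ε * δ) :=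
          mul_le_mul_of_nonneg_left hm (by positivity)
      _ = ε / 2 := by field_simp
  have h1 : 4 * Real.pi * (δ / 2) = ε / 2 := by rw [← hδdef]; field_simp
  linarith

end Literature.Barriers.FinalStateConjecture.Kerr

end
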